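import Summits.QuantumFields.YangMills.Theorems.BalabanUVNodesN15TwoSpacingGluingCurvedKnitAdjointDefect
import Summits.QuantumFields.YangMills.Theorems.BalabanUVNodesN15TwoSpacingGluingCurvedKnitSmallFieldPair
import HarnessLib

/-!
# THE TWO-GRID η-DEFECT OF ENTRY 2 (ADJOINT `cvGlued∘∇̂⁻_ν`) OF THE LIVE GLUED PROPAGATORS IN THE GLOBAL SMALL-FIELD GAUGE, EVERY ROW DISCHARGED —
# `𝔇_π̂(cvGlued′ … e^{η′A′} … ∘ ∇̂′⁻_ν, cvGlued … e^{ηĀ′} … ∘ ∇̂⁻_ν) ≤ D·((L^k)^{−1∕16} + (L^k)^{−1∕(8(d+1))} + scale·η)·e^{−(δ∕16)d}` for skew-Hermitian potentials in the C² window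
# (dag-n15-c g20, n15-c∕178 — FILE 139's pattern for n15-c∕177; N15 = NE2, s1 road (c) «print-faithful non-abelian G(U)», background-layer OPERATOR ingredient)

Cell `pub-ymgap`, seat `pub-ymgap-dag-n15-c` (R134 (a); HUMAN RULING D-0062), generation 20.  `bears_on: R4∕N15 · K3⁸ SpineGivenEndpointR13SepCoPHV (stmt-QuantumFields-27366)`.
Filed `--kind proof --supports stmt-QuantumFields-27366 --as helper` — COUNT-NEUTRAL.  Theorems only; 0 `def`, 0 `sorry`.  Imports BY NAME n15-c∕177 `…TwoSpacingGluingCurvedKnitAdjointDefect`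
(★★★ `one_idef_bgrad_cvGlued`) and FILE 133 `…CurvedKnitSmallFieldPair` (through it FILE 130's `conj_one_exp_eq_expTrField` ∕ `gavgM_conjTranspose_of_skew`, dag-n15-w2
`twoSidedLetters_curvCoef_one_of_meanGauge`, n15-b `curvCoefC_one` ∕ `curvCoefA_one`, the King-pairing geometry `bshiftEquiv_comm` ∕ `fibre_conn_kingPrV` ∕ `kingPrV_bshiftEquiv_pow`,
`coordMat_adCLM_transpose_eq_neg_of_conjTranspose`, `basisConst_nonneg`).  Nothing in the tree is modified; nothing restated.

WHAT.  ★★★ `sf_idef_bgrad_cvGlued` — n15-c∕177 `one_idef_bgrad_cvGlued` displays ONE hypothesis, dag-n15-w2's fifteen `TwoSidedLetters` of the species of `(U′, U)` at scale `r_S` and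
rate `θ`; here `U′ := e^{η′A′}`, `U := e^{ηĀ′}` (`Ā′ = gavgM π̂ A′`, King's block mean) for a skew-Hermitian `A′` in the C² window at scale `r_A` (sup `≤ r_A`, all one-step differences
`≤ r_Aη′`, all mixed second differences `≤ r_Aη′²`; `2(2+d)(5+2d)r_A ≤ 1`, `scale·(1+|J⊕J|) ≤ R₀` — FILE 133∕139's hypotheses VERBATIM), and the fifteen letters are PRODUCED by
`twoSidedLetters_curvCoef_one_of_meanGauge` at scale `scale = 14e(2+d)κ_e(2+d)(5+2d)r_A` and rate `θ = η = L^{−k}` (currency: `curvCoefC_one`∕`curvCoefA_one`, `conj_one_exp_eq_expTrField`):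
for odd `L ≥ 7`, `a > 0`, `ι`: `∃ δ w₀ R₀ D > 0, ∀ (m, k ≥ 1, L^m ≥ w₀, r) ν e A′ …`,
`𝔇_π̂(cvGlued′ … 1 e^{η′A′} (N′_L⊗1) 0 ∘ ∇̂′⁻_ν, cvGlued … 1 e^{ηĀ′} (N_L⊗1) 0 ∘ ∇̂⁻_ν) ≤ D·((L^k)^{−1∕16} + (L^k)^{−1∕(8(d+1))} + scale·η)·e^{−(δ∕16)|y−y′|}` blockwise (coarse unit blocks →
fine grid read on them) — the two-grid half of entry 2 of [Balaban1985BackgroundPropagators] (3.42) in the ADJOINT arrangement (the flat quotient `∇̂⁻_ν` on the right; the transport to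
`∇^{U*}_ν` is FILE 159's algebra) for the node's small-field family, with NO displayed row.

HONEST FRAMING ∕ LIMITS.  Assembly of n15-c∕177 with dag-n15-w2's letter bundle; MODEL operator (covariant Laplacian (3.50) ⊗ colour + FLAT nonlocal part (1.69)) ∕ MODEL class (global
gauge, C² window) ∕ King's pairing ∕ dag-n15-a's carriers; constants crude; the SHAPE of [B9] Thm 3.1 (3.42) entry 2 and of Thm 3.14's difference template, NOT the printed theorems;
nothing of [B5]∕[B6]∕[B9] asserted.  NE2 for non-abelian `G(U)` NOT proved (C-N15-1); N15 of record untouched (№253) — road (c)'s bookkeeping, NO count; K3⁸ skeleton untouched; one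
finite 𝕋⁴ at fixed ε — NOT infinite volume, NOT OS, NOT a mass gap, NOT Clay.  Restate-immune (no Theses import).
-/

noncomputable section

open scoped BigOperators Matrix Matrix.Norms.Frobenius

namespace Summit.QuantumFields.YangMills.BalabanUVNodes.N15.Gluing

open Literature.MathematicalPhysics.QuantumFieldTheory.Balaban1983to89
open Literature.MathematicalPhysics.QuantumFieldTheory.Balaban1983to89.B11SectG (BlockNorm HasMaj)
open Literature.MathematicalPhysics.QuantumFieldTheory.Balaban1983to89.T4EtaRateDefect (idef)
open Literature.MathematicalPhysics.QuantumFieldTheory.Balaban1983to89.T4EtaRateCoeffDefect (pull)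
open Literature.MathematicalPhysics.QuantumFieldTheory.Balaban1983to89.B6Prop26Gluing (mulOp)
open Literature.MathematicalPhysics.QuantumFieldTheory.Balaban1983to89.B6UnitTorusCarrier (unitTorusGeo unitTorusGeo_dist_nonneg)
open Literature.MathematicalPhysics.QuantumFieldTheory.King1986.Torus (blockOf)
open Literature.Barriers.QuantumFields (traceForm)
open Literature.MathematicalPhysics.QuantumFieldTheory.Balaban1983to89.Beta.AveragingCorrectionJets (adCLM)
open Summit.QuantumFields.YangMills.BalabanUVNodes.N15.BackgroundLayer (bgrad covLapM tCoefA tCoefC gavgM fgradMat TwoSidedLetters)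
open Summit.QuantumFields.YangMills.BalabanUVNodes.N15.VectorPiece (bshiftEquiv kingPrV kingPrV_bshiftEquiv_pow fibre_conn_kingPrV bshiftEquiv_comm)
open Summit.QuantumFields.YangMills.BalabanUVNodes.N15.MatrixSpecies (mmulOp coordMat basisConst basisConst_nonneg liftBlk liftMap liftEquiv)
open Summit.QuantumFields.YangMills.BalabanUVNodes.N15.CurvedSpecies (gaugePair expTrField curvCoefC_one curvCoefA_one twoSidedLetters_curvCoef_one_of_meanGauge
  coordMat_adCLM_transpose_eq_neg_of_conjTranspose)

variable {d : ℕ} {L : ℕ} [NeZero L]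

set_option maxHeartbeats 800000 in
/-- ★★★ **THE TWO-GRID η-DEFECT OF ENTRY 2 `cvGlued∘∇̂⁻_ν` IN THE GLOBAL SMALL-FIELD GAUGE, EVERY ROW DISCHARGED** — n15-c∕177 with the fifteen letters of `(e^{η′A′}, e^{ηĀ′})`,
`Ā′ = gavgM π̂ A′`, produced from the C² window of the fine potential `A′` (FILE 133∕139's hypotheses verbatim) at scale `14e(2+d)κ_e(2+d)(5+2d)r_A` and rate `η = L^{−k}`.  MODEL
operator ∕ class ∕ pairing ∕ carriers; NOT [B9] Thm 3.1∕3.14 as printed. [cite: Balaban1985BackgroundPropagators, Thm 3.1 p.397 ((3.42), entry `G∇*`: shape), Thm 3.14 pp.426–427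
(difference template), (3.34)–(3.36) p.396, (3.50)–(3.52) p.400; Balaban1984PropagatorsII, (2.133)–(2.136) p.247; King1986, p.664 (pairing), Prop. 3.9 (3.73) p.665 (rate shape)] -/
theorem sf_idef_bgrad_cvGlued (hL : Odd L ∧ 1 < L) (hL7 : 7 ≤ L) {a : ℝ} (ha : 0 < a) (ι : Type) [Fintype ι] [DecidableEq ι] :
    ∃ δ w₀ R₀ D : ℝ, 0 < δ ∧ 0 < R₀ ∧ 0 < D ∧
      ∀ (mv kk r : ℕ) (ν : Fin (d + 1)), 1 ≤ kk → w₀ ≤ ((L ^ mv : ℕ) : ℝ) →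
      ∀ {mm : Type} [Fintype mm] [DecidableEq mm] (e : Matrix mm mm ℂ ≃L[ℝ] (ι → ℝ)), (∀ A B : Matrix mm mm ℂ, traceForm A B = e A ⬝ᵥ e B) →
      ∀ (A' : Fin (d + 1) → CvX' d L mv kk r hL → Matrix mm mm ℂ), (∀ μ x', (A' μ x')ᴴ = -A' μ x') →
      ∀ (rA : ℝ), 0 ≤ rA → (∀ μ x', ‖A' μ x'‖ ≤ rA) →
        (∀ μ κ x', ‖A' μ ((bshiftEquiv (cvM d L mv kk hL) (L ^ r * L ^ kk)) κ x') - A' μ x'‖ ≤ rA * ((((L ^ r * L ^ kk : ℕ) : ℝ))⁻¹)) →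
        (∀ μ κ x', ‖(A' μ ((bshiftEquiv (cvM d L mv kk hL) (L ^ r * L ^ kk)) κ x') - A' μ x') -
            (A' μ ((bshiftEquiv (cvM d L mv kk hL) (L ^ r * L ^ kk)) κ (((bshiftEquiv (cvM d L mv kk hL) (L ^ r * L ^ kk)) μ).symm x')) - A' μ (((bshiftEquiv (cvM d L mv kk hL) (L ^ r * L ^ kk)) μ).symm x'))‖ ≤ rA * ((((L ^ r * L ^ kk : ℕ) : ℝ))⁻¹) * ((((L ^ r * L ^ kk : ℕ) : ℝ))⁻¹)) →
        2 * ((1 + Fintype.card (Fin (d + 1))) * ((3 + 2 * ((d : ℝ) + 1)) * rA)) ≤ 1 →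
        (14 * Real.exp 1 * (1 + Fintype.card (Fin (d + 1))) * basisConst e * ((1 + Fintype.card (Fin (d + 1))) * ((3 + 2 * ((d : ℝ) + 1)) * rA))) * (1 + Fintype.card (Fin (d + 1) ⊕ Fin (d + 1))) ≤ R₀ →
        HasMaj (CvNorm d L mv kk hL ι) (BlockNorm.ofBlocks (unitTorusGeo L kk (cvM d L mv kk hL)) (liftBlk (cvBlk d L mv kk hL ∘ (kingPrV L kk r (cvM d L mv kk hL))) ι))
          (idef (pull (liftMap (kingPrV L kk r (cvM d L mv kk hL)) ι)) (pull (liftMap (kingPrV L kk r (cvM d L mv kk hL)) ι))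
            ((cvGlued' d L mv kk r hL a ((((L ^ r * L ^ kk : ℕ) : ℝ))⁻¹) ι e (fun _ _ => (1 : Matrix mm mm ℂ)) (fun μ x' => NormedSpace.exp (((((L ^ r * L ^ kk : ℕ) : ℝ))⁻¹) • A' μ x')) (cvNL' d L mv kk r hL a ι) (fun _ => 0)) ∘ₗ bgrad ((((L ^ r * L ^ kk : ℕ) : ℝ))⁻¹)⁻¹ (liftEquiv ((bshiftEquiv (cvM d L mv kk hL) (L ^ r * L ^ kk)) ν) ι))
            ((cvGlued d L mv kk hL a ((((L ^ kk : ℕ) : ℝ))⁻¹) ι e (fun _ _ => (1 : Matrix mm mm ℂ)) (fun μ x => NormedSpace.exp (((((L ^ kk : ℕ) : ℝ))⁻¹) • gavgM (Matrix mm mm ℂ) (Fin (d + 1)) (kingPrV L kk r (cvM d L mv kk hL)) A' μ x)) (cvNL d L mv kk hL a ι) (fun _ => 0)) ∘ₗ bgrad ((((L ^ kk : ℕ) : ℝ))⁻¹)⁻¹ (liftEquiv ((bshiftEquiv (cvM d L mv kk hL) (L ^ kk)) ν) ι)))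
          (fun y y' => D * (((L ^ kk : ℕ) : ℝ) ^ (-(1 / 16 : ℝ)) + ((L ^ kk : ℕ) : ℝ) ^ (-(1 / (8 * ((d : ℝ) + 1)))) + (14 * Real.exp 1 * (1 + Fintype.card (Fin (d + 1))) * basisConst e * ((1 + Fintype.card (Fin (d + 1))) * ((3 + 2 * ((d : ℝ) + 1)) * rA))) * ((((L ^ kk : ℕ) : ℝ))⁻¹)) *
            Real.exp (-(δ / 16 * (unitTorusGeo L kk (cvM d L mv kk hL)).dist y y'))) := by
  have hLpos : 0 < L := Nat.pos_of_ne_zero (NeZero.ne L)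
  obtain ⟨δ₁, w₁, R₁, D₁, hδ₁, hR₁, hD₁, H₁⟩ := one_idef_bgrad_cvGlued (d := d) hL hL7 ha ι
  refine ⟨δ₁, w₁, R₁, D₁, hδ₁, hR₁, hD₁, fun mv kk r ν hk hw₀ => ?_⟩
  intro mm _ _ e he A' hA' rA hrA h1 h2 h3 hr2 hRle
  -- the two spacings
  have hkpos : (0 : ℝ) < ((L ^ kk : ℕ) : ℝ) := Nat.cast_pos.mpr (pow_pos hLpos kk)
  have hrkpos : (0 : ℝ) < ((L ^ r * L ^ kk : ℕ) : ℝ) := Nat.cast_pos.mpr (Nat.mul_pos (pow_pos hLpos r) (pow_pos hLpos kk))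
  have hη : (0 : ℝ) < ((((L ^ kk : ℕ) : ℝ))⁻¹) := inv_pos.mpr hkpos
  have hη' : (0 : ℝ) < ((((L ^ r * L ^ kk : ℕ) : ℝ))⁻¹) := inv_pos.mpr hrkpos
  have hN : ((((L ^ kk : ℕ) : ℝ))⁻¹) = ((L ^ r : ℕ) : ℝ) * ((((L ^ r * L ^ kk : ℕ) : ℝ))⁻¹) := by
    have hr0 : ((L ^ r : ℕ) : ℝ) ≠ 0 := Nat.cast_ne_zero.mpr (pow_ne_zero _ (NeZero.ne L))
    rw [Nat.cast_mul]; field_simp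
  have hη1 : ((((L ^ kk : ℕ) : ℝ))⁻¹) ≤ 1 := inv_le_one_of_one_le₀ (by exact_mod_cast Nat.one_le_pow kk L hLpos)
  have hC₀ : (0 : ℝ) ≤ 2 * ((d : ℝ) + 1) := by positivity
  have hCθ : ((2 * ((d + 1) * (L ^ r - 1)) : ℕ) : ℝ) * ((((L ^ r * L ^ kk : ℕ) : ℝ))⁻¹) ≤ 2 * ((d : ℝ) + 1) * ((((L ^ kk : ℕ) : ℝ))⁻¹) := by
    have hsub : (((L ^ r - 1 : ℕ)) : ℝ) ≤ ((L ^ r : ℕ) : ℝ) := by exact_mod_cast Nat.sub_le _ _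
    have hcast : ((2 * ((d + 1) * (L ^ r - 1)) : ℕ) : ℝ) = 2 * ((d : ℝ) + 1) * (((L ^ r - 1 : ℕ)) : ℝ) := by push_cast; ring
    rw [hcast, hN]
    calc 2 * ((d : ℝ) + 1) * (((L ^ r - 1 : ℕ)) : ℝ) * ((((L ^ r * L ^ kk : ℕ) : ℝ))⁻¹) ≤ 2 * ((d : ℝ) + 1) * ((L ^ r : ℕ) : ℝ) * ((((L ^ r * L ^ kk : ℕ) : ℝ))⁻¹) :=
          mul_le_mul_of_nonneg_right (mul_le_mul_of_nonneg_left hsub hC₀) hη'.le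
      _ = 2 * ((d : ℝ) + 1) * (((L ^ r : ℕ) : ℝ) * ((((L ^ r * L ^ kk : ℕ) : ℝ))⁻¹)) := by ring
  -- King's pairing geometry and skewness in coordinates (as FILE 133∕139)
  have hcomm := fun μ κ (x : CvX' d L mv kk r hL) => bshiftEquiv_comm (cvM d L mv kk hL) (L ^ r * L ^ kk) μ κ x
  have hconn := fun (f : CvX' d L mv kk r hL → Matrix mm mm ℂ) (β : ℝ)
      (hf : ∀ κ x, ‖f ((bshiftEquiv (cvM d L mv kk hL) (L ^ r * L ^ kk)) κ x) - f x‖ ≤ β) => fibre_conn_kingPrV L kk r (cvM d L mv kk hL) f β hf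
  have hblk := fun μ (x' : CvX' d L mv kk r hL) => kingPrV_bshiftEquiv_pow L kk r (cvM d L mv kk hL) μ x'
  have hAm : ∀ μ x, (gavgM (Matrix mm mm ℂ) (Fin (d + 1)) (kingPrV L kk r (cvM d L mv kk hL)) A' μ x)ᴴ = -gavgM (Matrix mm mm ℂ) (Fin (d + 1)) (kingPrV L kk r (cvM d L mv kk hL)) A' μ x :=
    gavgM_conjTranspose_of_skew (kingPrV L kk r (cvM d L mv kk hL)) hA'
  have hA'c := fun μ x' => coordMat_adCLM_transpose_eq_neg_of_conjTranspose e he (hA' μ x')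
  have hAmc := fun μ x => coordMat_adCLM_transpose_eq_neg_of_conjTranspose e he (hAm μ x)
  -- the fifteen letters at scale `scale`, rate `θ = η`, converted to the dressed-bond currency of n15-c∕177
  have hTS := twoSidedLetters_curvCoef_one_of_meanGauge e (π := (kingPrV L kk r (cvM d L mv kk hL))) (s := (bshiftEquiv (cvM d L mv kk hL) (L ^ kk))) (s' := (bshiftEquiv (cvM d L mv kk hL) (L ^ r * L ^ kk))) (N := L ^ r) (θ := ((((L ^ kk : ℕ) : ℝ))⁻¹)) (Cπ := ((2 * ((d + 1) * (L ^ r - 1)) : ℕ) : ℝ))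
      (C₀ := 2 * ((d : ℝ) + 1)) hcomm hconn hblk hη' hN hη hη1 le_rfl hC₀ hCθ hrA hr2 hA'c hAmc h1 h2 h3
  rw [curvCoefC_one, curvCoefA_one, curvCoefC_one, curvCoefA_one, ← conj_one_exp_eq_expTrField e ((((L ^ r * L ^ kk : ℕ) : ℝ))⁻¹) hA', ← conj_one_exp_eq_expTrField e ((((L ^ kk : ℕ) : ℝ))⁻¹) hAm] at hTS
  -- the scale is admissible for n15-c∕177
  have hκ0 : 0 ≤ basisConst e := basisConst_nonneg e
  have hS0 : 0 ≤ (14 * Real.exp 1 * (1 + Fintype.card (Fin (d + 1))) * basisConst e * ((1 + Fintype.card (Fin (d + 1))) * ((3 + 2 * ((d : ℝ) + 1)) * rA))) := by positivity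
  have hR₁le : (14 * Real.exp 1 * (1 + Fintype.card (Fin (d + 1))) * basisConst e * ((1 + Fintype.card (Fin (d + 1))) * ((3 + 2 * ((d : ℝ) + 1)) * rA))) ≤ R₁ := by
    have hJJ : (1 : ℝ) ≤ 1 + Fintype.card (Fin (d + 1) ⊕ Fin (d + 1)) := by
      have : (0 : ℝ) ≤ Fintype.card (Fin (d + 1) ⊕ Fin (d + 1)) := by positivity
      linarith
    exact (le_mul_of_one_le_right hS0 hJJ).trans hRle
  exact H₁ mv kk r ν hk hw₀ e he (fun μ x => NormedSpace.exp (((((L ^ kk : ℕ) : ℝ))⁻¹) • gavgM (Matrix mm mm ℂ) (Fin (d + 1)) (kingPrV L kk r (cvM d L mv kk hL)) A' μ x)) (fun μ x' => NormedSpace.exp (((((L ^ r * L ^ kk : ℕ) : ℝ))⁻¹) • A' μ x')) (14 * Real.exp 1 * (1 + Fintype.card (Fin (d + 1))) * basisConst e * ((1 + Fintype.card (Fin (d + 1))) * ((3 + 2 * ((d : ℝ) + 1)) * rA))) ((((L ^ kk : ℕ) : ℝ))⁻¹) hS0 hη.le hR₁le hTS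

end Summit.QuantumFields.YangMills.BalabanUVNodes.N15.Gluing

end
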